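import Literature.Analysis.FluidPDE.LerayHopf
import HarnessLib

/-!
# Restriction in time of Leray–Hopf solutions on the flat torus (Leray 1934, §III): the proof

Analysis/FluidPDE support file (theorem-only) containing the discharge
`Literature.Analysis.FluidPDE.Torus.IsLerayHopfOn.mono_holds` of the named fact
`Literature.Analysis.FluidPDE.Torus.IsLerayHopfOn.mono` (`FluidPDE/LerayHopf`, torus side): a
Leray–Hopf weak solution on `T^d × [0, T)` is one on `T^d × [0, T')` for every `T' ≤ T`. It is the
torus twin of the accepted whole-space discharge `Literature.Analysis.FluidPDE.IsLerayHopfOn.mono_holds`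
(`FluidPDE/LerayHopfProofs`) and follows the same printed argument (Leray 1934, §III: the defining
relations of a "solution turbulente" on `[0, T)` are relations on sub-intervals; Galdi 2000,
Def. 2.1 and Remark 2.1).

Contents, in the order of the proof:

* `Torus.IsWeakNSSolutionForcedOn.of_le` — the forced weak (pressure-free) formulation with datum
  restricts from `[0, T)` to `[0, T')`: measurability, the `L²_{t,x}` bound and the a.e. weak
  divergence constraint restrict along `(0, T') ⊆ (0, T)`; a test field vanishing for `t ≥ T''`
  with `T'' < T'` is a test field for `[0, T)`, and its slices `ψ t`, together with `∂ₜψ t`,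
  `(u·∇)ψ t`, `Δψ t`, vanish for `t ≥ T'`, so the weak integrands over `(0, T)` and `(0, T')`
  agree (`setIntegral_eq_of_subset_of_forall_sdiff_eq_zero`);
* `Torus.IsLerayHopfOn.mono_holds` (usable form `Torus.IsLerayHopfOn.of_le`) — the remaining
  fields of `Torus.IsLerayHopfOn` restrict along `Ioo 0 T' ⊆ Ioo 0 T` (`ae_mono`,
  `lintegral_mono_set` for the spectral `L²_t H¹_x` bound `Torus.MemL2Sobolev`), `Icc 0 T' ⊆ Icc 0 T`,
  `Icc s T' ⊆ Icc s T`, `Ioc 0 T' ⊆ Ioc 0 T`; the two conditions at `t → 0⁺` do not see `T`.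

No new definition, no new named fact.

## References

* J. Leray, *Sur le mouvement d'un liquide visqueux emplissant l'espace*, Acta Math. 63 (1934),
  193–248, §III. [Leray1934]
* G. P. Galdi, *An introduction to the Navier–Stokes initial–boundary value problem* (2000),
  Def. 2.1, Remark 2.1. [Galdi2000]
-/

noncomputable section

open MeasureTheory Set Function Filter
open scoped RealInnerProductSpace ENNReal NNReal Topology

namespace Literature.Analysis.FluidPDE.Torus

variable {d : Type*} [Fintype d] [DecidableEq d]

/-! ### Vanishing of test fields past their support in time -/

section TestVanish

variable {F : Type*} [NormedAddCommGroup F] [NormedSpace ℝ F]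

omit [DecidableEq d] in
/-- A space–time test field on `[0, T')` is one on `[0, T)` for every `T ≥ T'` (the vanishing
threshold `T'' < T'` is also `< T`). [folklore] -/
private theorem lhMono_isSpaceTimeTest_of_le {T T' : ℝ} {ψ : ℝ → UnitAddTorus d → F}
    (hψ : FunctionSpaces.Torus.IsSpaceTimeTest T' ψ) (hT : T' ≤ T) :
    FunctionSpaces.Torus.IsSpaceTimeTest T ψ := by
  obtain ⟨hs, T'', hT'', h⟩ := hψ
  exact ⟨hs, T'', hT''.trans_le hT, h⟩

omit [Fintype d] [DecidableEq d] in
/-- Past the vanishing threshold the time derivative of a test field vanishes: if `ψ s = 0` for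
all `s ≥ T''` and `T'' < t`, then `∂ₜψ (t, x) = 0` (`ψ(·, x)` is constant near `t`). [folklore] -/
private theorem lhMono_timeDeriv_eq_zero {T'' t : ℝ} {ψ : ℝ → UnitAddTorus d → F}
    (h : ∀ s, T'' ≤ s → ψ s = 0) (ht : T'' < t) (x : UnitAddTorus d) :
    FunctionSpaces.Torus.timeDeriv ψ t x = 0 := by
  have h1 : (fun s => ψ s x) =ᶠ[𝓝 t] fun _ => (0 : F) := by
    filter_upwards [Ioi_mem_nhds ht] with s hs
    rw [h s (le_of_lt hs), Pi.zero_apply]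
  rw [FunctionSpaces.Torus.timeDeriv, h1.deriv_eq, deriv_const]

omit [Fintype d] [DecidableEq d] in
/-- The torus Fréchet derivative of the zero field vanishes. [folklore] -/
private theorem lhMono_fderiv_zero (x : UnitAddTorus d) :
    FunctionSpaces.Torus.fderiv (0 : UnitAddTorus d → F) x = 0 := by
  have h : FunctionSpaces.Torus.liftAt (0 : UnitAddTorus d → F) x = fun _ => (0 : F) :=
    funext fun _ => rfl
  rw [FunctionSpaces.Torus.fderiv, h, fderiv_fun_const, Pi.zero_apply]

omit [DecidableEq d] in
/-- The torus Laplacian of the zero field vanishes. [folklore] -/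
private theorem lhMono_laplacian_zero (x : UnitAddTorus d) :
    FunctionSpaces.Torus.laplacian (0 : UnitAddTorus d → F) x = 0 := by
  have h : FunctionSpaces.Torus.liftAt (0 : UnitAddTorus d → F) x = fun _ => (0 : F) :=
    funext fun _ => rfl
  rw [FunctionSpaces.Torus.laplacian, h, InnerProductSpace.laplacian_const, Pi.zero_apply]

end TestVanish

/-! ### Time restriction of forced weak solutions with datum -/

section WeakRestrict

variable {T T' ν : ℝ} {f u : ℝ → UnitAddTorus d → EuclideanSpace ℝ d}
  {u₀ : UnitAddTorus d → EuclideanSpace ℝ d}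

/-- **Restriction in time of forced weak solutions on the torus.** A forced weak (pressure-free)
solution with datum `u₀` on `T^d × [0, T)` is one on `T^d × [0, T')` for every `T' ≤ T`:
measurability, the `L²_{t,x}` bound and the a.e. weak divergence constraint restrict along
`(0, T') × T^d ⊆ (0, T) × T^d`; a divergence-free test field for `[0, T')` is one for `[0, T)`,
and since its slices vanish identically for `t ≥ T'` (together with `∂ₜψ`, `(u·∇)ψ`, `Δψ`), the
weak integrand vanishes on `[T', T)` and `∫_{(0,T)} = ∫_{(0,T')}` (Leray 1934, §III, relations
(3.2)–(3.5) of a turbulent solution on sub-intervals; torus twin of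
`Literature.Analysis.FluidPDE.IsWeakNSSolutionOn.of_le`). [cite: Leray1934, §III] -/
theorem IsWeakNSSolutionForcedOn.of_le (h : IsWeakNSSolutionForcedOn T ν f u₀ u) (hT : T' ≤ T) :
    IsWeakNSSolutionForcedOn T' ν f u₀ u := by
  obtain ⟨hmeas, hL2, hdiv, hweak⟩ := h
  have hsub : Ioo (0 : ℝ) T' ⊆ Ioo 0 T := Ioo_subset_Ioo_right hT
  have hsub' : Ioo (0 : ℝ) T' ×ˢ (univ : Set (EuclideanSpace ℝ d)) ⊆ Ioo 0 T ×ˢ univ :=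
    prod_mono hsub Subset.rfl
  refine ⟨hmeas.mono_measure (Measure.restrict_mono (μ := volume) (ν := volume) hsub' le_rfl),
    lt_of_le_of_lt (lintegral_mono_set hsub) hL2,
    ae_mono (Measure.restrict_mono hsub le_rfl) hdiv, fun ψ hψ hψdiv => ?_⟩
  have key := hweak ψ (lhMono_isSpaceTimeTest_of_le hψ hT) hψdiv
  rw [setIntegral_eq_of_subset_of_forall_sdiff_eq_zero measurableSet_Ioo hsub] at key
  · exact key
  · intro t ht
    obtain ⟨_, T'', hT'', hvan⟩ := hψ
    have htT : T'' < t := by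
      have : T' ≤ t := by
        by_contra hlt
        exact ht.2 ⟨ht.1.1, lt_of_not_ge hlt⟩
      exact hT''.trans_le this
    have h4 : ψ t = 0 := hvan t htT.le
    have h1 : ∀ x, FunctionSpaces.Torus.timeDeriv ψ t x = 0 :=
      fun x => lhMono_timeDeriv_eq_zero hvan htT x
    have h2 : ∀ x, FunctionSpaces.Torus.convect (u t) (0 : UnitAddTorus d → EuclideanSpace ℝ d) x = 0 :=
      fun x => by simp [FunctionSpaces.Torus.convect, lhMono_fderiv_zero]
    have h3 : ∀ x, FunctionSpaces.Torus.laplacian (0 : UnitAddTorus d → EuclideanSpace ℝ d) x = 0 :=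
      fun x => lhMono_laplacian_zero x
    simp [h1, h2, h3, h4]

end WeakRestrict

end Literature.Analysis.FluidPDE.Torus

/-! ### Time restriction of Leray–Hopf solutions: the discharge

(Declared from the parent namespace with explicit `Torus.` prefixes, so that the statements print
distinctly from their whole-space twins in `FluidPDE/LerayHopfProofs`.) -/

namespace Literature.Analysis.FluidPDE

variable {d : Type*} [Fintype d] [DecidableEq d]

section LerayHopfMono

variable {T T' ν : ℝ} {f u : ℝ → UnitAddTorus d → EuclideanSpace ℝ d}
  {u₀ : UnitAddTorus d → EuclideanSpace ℝ d}

omit [DecidableEq d] in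
/-- The spectral `L²(0, T; H^s)` class restricts to `(0, T')`, `T' ≤ T` (a.e. membership along
`Ioo 0 T' ⊆ Ioo 0 T`, the time integral by monotonicity of the lower integral in the set). [folklore] -/
private theorem Torus.lhMono_memL2Sobolev_of_le {F : Type*} [NormedAddCommGroup F] [NormedSpace ℂ F]
    {s : ℝ} {v : ℝ → UnitAddTorus d → F}
    (hv : FunctionSpaces.Torus.MemL2Sobolev 0 T s v) (hT : T' ≤ T) :
    FunctionSpaces.Torus.MemL2Sobolev 0 T' s v := by
  have hsub : Ioo (0 : ℝ) T' ⊆ Ioo 0 T := Ioo_subset_Ioo_right hT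
  refine ⟨ae_mono (Measure.restrict_mono hsub le_rfl) hv.1, lt_of_le_of_lt ?_ hv.2⟩
  unfold FunctionSpaces.Torus.eL2SobolevNorm
  exact ENNReal.rpow_le_rpow (lintegral_mono_set hsub) (by norm_num)

/-- **Discharge of `Torus.IsLerayHopfOn.mono`** (`LerayHopf`, torus side; Leray 1934, §III): a
Leray–Hopf weak solution on `T^d × [0, T)` is one on `T^d × [0, T')` for every `T' ≤ T`. The
forced weak formulation restricts by `Torus.IsWeakNSSolutionForcedOn.of_le`; the `L^∞_t L²_x`
bound and the a.e.-`s` energy inequality restrict along `Ioo 0 T' ⊆ Ioo 0 T` (`ae_mono`), the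
spectral `L²_t H¹_x` bound by monotonicity of the lower integral in the time set, the slice
conditions along `Icc 0 T' ⊆ Icc 0 T`, `Icc s T' ⊆ Icc s T`, weak continuity along
`Ioc 0 T' ⊆ Ioc 0 T`; the two conditions at `t → 0⁺` do not see `T` (torus twin of
`Literature.Analysis.FluidPDE.IsLerayHopfOn.mono_holds`; Galdi 2000, Def. 2.1). [cite: Leray1934, §III] -/
theorem Torus.IsLerayHopfOn.mono_holds :
    Torus.IsLerayHopfOn.mono (T := T) (T' := T') (ν := ν) (f := f) (u₀ := u₀) (u := u) := by
  intro h hT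
  have hIoo : Ioo (0 : ℝ) T' ⊆ Ioo 0 T := Ioo_subset_Ioo_right hT
  have hIcc : Icc (0 : ℝ) T' ⊆ Icc 0 T := Icc_subset_Icc_right hT
  have hμ : volume.restrict (Ioo (0 : ℝ) T') ≤ volume.restrict (Ioo 0 T) :=
    Measure.restrict_mono hIoo le_rfl
  obtain ⟨C, hC⟩ := h.energy_bound
  refine
    { weak := h.weak.of_le hT
      energy_bound := ⟨C, ae_mono hμ hC⟩
      memLp := fun t ht => h.memLp t (hIcc ht)
      memL2Sobolev := Torus.lhMono_memL2Sobolev_of_le h.memL2Sobolev hT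
      energy_ineq_zero := fun t ht => h.energy_ineq_zero t (hIcc ht)
      energy_ineq_ae := ?_
      weak_continuous := fun w hw =>
        ⟨(h.weak_continuous w hw).1.mono (Ioc_subset_Ioc_right hT), (h.weak_continuous w hw).2⟩
      strong_initial := h.strong_initial }
  filter_upwards [ae_mono hμ h.energy_ineq_ae] with s hs t ht
  exact hs t (Icc_subset_Icc_right hT ht)

/-- The restriction of a Leray–Hopf solution on the torus to a shorter time interval, as a usable
lemma (`Torus.IsLerayHopfOn.mono_holds`; Leray 1934, §III). [cite: Leray1934, §III] -/
theorem Torus.IsLerayHopfOn.of_le (h : Torus.IsLerayHopfOn T ν f u₀ u) (hT : T' ≤ T) :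
    Torus.IsLerayHopfOn T' ν f u₀ u :=
  Torus.IsLerayHopfOn.mono_holds h hT

/-- A global Leray–Hopf solution on the torus restricts to a Leray–Hopf solution on every
`[0, T)` — including `T ≤ 0`, where the predicate only retains the conditions at `t → 0⁺`
(`Torus.IsGlobalLerayHopf.isLerayHopfOn` for `T > 0`, then `Torus.IsLerayHopfOn.of_le`). [cite: Leray1934, §III] -/
theorem Torus.IsGlobalLerayHopf.isLerayHopfOn_of_le (h : Torus.IsGlobalLerayHopf ν f u₀ u)
    (T : ℝ) : Torus.IsLerayHopfOn T ν f u₀ u :=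
  (h (max T 1) (lt_max_of_lt_right one_pos)).of_le (le_max_left T 1)

end LerayHopfMono

end Literature.Analysis.FluidPDE

end
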